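import Summits.Ventures.HodgeRepro2.T5SU11JacobiThreshold

/-!
# The growth of the spherical functions outside the complementary range, `φ_λ(a_t) ≤ e^{|λ − 1| t}`, and
the Paley–Wiener-type growth of the spherical transform of a function of bounded Cartan support

`T5SU11SphericalBounds` gives `φ_λ ≤ 1` for `0 ≤ λ ≤ 2`; for `λ ≤ 0` the Laplace integral with base
`≤ e^{2t}` (`T5SU11SphericalLpSharp.laplace_base_le_exp`) gives **`φ_λ(a_t) ≤ e^{-λ t}`**
(`sph_hyp_le_exp_of_nonpos`), and the functional equation gives `φ_λ(a_t) ≤ e^{(λ − 2) t}` for `λ ≥ 2`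
(`sph_hyp_le_exp_of_two_le`). Uniformly: **`φ_λ(a_t) ≤ e^{|λ − 1| t}` for every `λ` and `t ≥ 0`**
(`sph_hyp_le_exp_abs_sub_one`), i.e. `φ_λ(g) ≤ e^{|λ − 1| T(g)}` on the group
(`sph_le_exp_abs_sub_one_mul_cartanT`); with the lower bound `c_λ |a(g)|^{-λ} ≤ φ_λ(g)` of
`T5SU11JacobiThreshold` this is the two-sided exponential control of the spherical functions for every
real parameter. Consequently the spherical transform of a function supported in the Cartan ball
`{T(g) ≤ R}` grows at most like `e^{|λ − 1| R}`:
**`|∫_G f φ_λ dν| ≤ e^{|λ − 1| R} ∫_G |f| dν`** (`norm_integral_mul_sph_le_of_cartan_support`) — the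
Paley–Wiener-type growth bound, with the one-dimensional form
`|∫_0^R sinh 2t u φ_λ(a_t) dt| ≤ e^{|λ − 1| R} ∫_0^R sinh 2t |u| dt` (`abs_integral_mul_sph_hyp_le`).
Nothing is claimed about (N).

Blind lane: Mathlib + the HodgeRepro2 prefix only; no sorry; axioms ⊆ {propext, Classical.choice,
Quot.sound}.
-/

namespace Summit.Ventures.HodgeRepro2.T5SU11SphericalGrowth

open MeasureTheory MeasureTheory.Measure Metric Set Filter Topology intervalIntegral
open T5SU11Unimodular T5SU11Fibration T5SU11Cartan T5SU11OneParameter T5SU11CartanProjection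
  T5HaarCircle T5BergmanCoefficient T5SU11FibrationHaar T5SU11SphericalFunction
  T5SU11SphericalSymmetry T5SU11SphericalBounds T5SU11SphericalContinuous T5SU11SphericalLpSharp
  T5SU11JacobiThreshold
open scoped Real

section measure

variable [MeasurableSpace Circle] [BorelSpace Circle]

/-! ### The upper bounds outside `[0, 2]` -/

/-- **`φ_λ(a_t) ≤ e^{-λ t}` for `λ ≤ 0`, `t ≥ 0`** (the Laplace base is `≤ e^{2t}`). -/
theorem sph_hyp_le_exp_of_nonpos {lam : ℝ} (hlam : lam ≤ 0) {t : ℝ} (ht : 0 ≤ t) :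
    sph lam (hyp t) ≤ Real.exp (-lam * t) := by
  have hπ := Real.pi_pos
  rw [sph_hyp_eq_laplace]
  have h : ∫ φ in (-π)..π, (Real.cosh (2 * t) - Real.sinh (2 * t) * Real.cos φ) ^ (-lam / 2)
      ≤ ∫ φ in (-π)..π, Real.exp (-lam * t) := by
    refine integral_mono_on (by linarith) ?_ intervalIntegrable_const fun φ _ => ?_
    · have h1 : Continuous fun φ => Real.cosh (2 * t) - Real.sinh (2 * t) * Real.cos φ := by
        fun_prop
      exact (h1.rpow_const fun φ => Or.inl (laplace_base_pos t φ).ne').intervalIntegrable _ _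
    · calc (Real.cosh (2 * t) - Real.sinh (2 * t) * Real.cos φ) ^ (-lam / 2)
          ≤ Real.exp (2 * t) ^ (-lam / 2) :=
            Real.rpow_le_rpow (laplace_base_pos t φ).le (laplace_base_le_exp ht φ) (by linarith)
        _ = Real.exp (-lam * t) := by rw [exp_two_mul_rpow]; ring_nf
  rw [intervalIntegral.integral_const, smul_eq_mul] at h
  calc (2 * π)⁻¹ * ∫ φ in (-π)..π,
        (Real.cosh (2 * t) - Real.sinh (2 * t) * Real.cos φ) ^ (-lam / 2)
      ≤ (2 * π)⁻¹ * ((π - -π) * Real.exp (-lam * t)) := by gcongr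
    _ = Real.exp (-lam * t) := by field_simp; ring

/-- **`φ_λ(a_t) ≤ e^{(λ − 2) t}` for `λ ≥ 2`, `t ≥ 0`** (the functional equation). -/
theorem sph_hyp_le_exp_of_two_le {lam : ℝ} (hlam : 2 ≤ lam) {t : ℝ} (ht : 0 ≤ t) :
    sph lam (hyp t) ≤ Real.exp ((lam - 2) * t) := by
  have h := sph_hyp_le_exp_of_nonpos (lam := 2 - lam) (by linarith) ht
  rw [← sph_two_sub] at h
  rw [show (lam - 2) * t = -(2 - lam) * t by ring]
  exact h

/-- **The uniform growth bound `φ_λ(a_t) ≤ e^{|λ − 1| t}`** for every `λ` and `t ≥ 0`. -/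
theorem sph_hyp_le_exp_abs_sub_one (lam : ℝ) {t : ℝ} (ht : 0 ≤ t) :
    sph lam (hyp t) ≤ Real.exp (|lam - 1| * t) := by
  rcases le_or_gt lam 0 with h0 | h0
  · refine (sph_hyp_le_exp_of_nonpos h0 ht).trans (Real.exp_le_exp.mpr ?_)
    have : -lam ≤ |lam - 1| := by
      rw [abs_of_nonpos (by linarith)]
      linarith
    exact mul_le_mul_of_nonneg_right this ht
  rcases le_or_gt lam 2 with h2 | h2
  · refine (sph_hyp_le_one h0.le h2 t).trans ?_
    exact Real.one_le_exp (by positivity)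
  · refine (sph_hyp_le_exp_of_two_le h2.le ht).trans (Real.exp_le_exp.mpr ?_)
    have : lam - 2 ≤ |lam - 1| := by
      rw [abs_of_nonneg (by linarith)]
      linarith
    exact mul_le_mul_of_nonneg_right this ht

/-- **On the group**: `φ_λ(g) ≤ e^{|λ − 1| T(g)}`, `T = cartanT`. -/
theorem sph_le_exp_abs_sub_one_mul_cartanT (lam : ℝ) (g : SU11) :
    sph lam g ≤ Real.exp (|lam - 1| * cartanT g) := by
  rw [sph_eq_sph_hyp_cartanT]
  exact sph_hyp_le_exp_abs_sub_one lam (cartanT_nonneg g)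

/-- **Two-sided exponential control**: for every `λ` there is `c > 0` with
`c |a(g)|^{-λ} ≤ φ_λ(g) ≤ e^{|λ − 1| T(g)}` for all `g`. -/
theorem exists_two_sided_bound (lam : ℝ) :
    ∃ c : ℝ, 0 < c ∧ ∀ g : SU11,
      c * ‖mat g 0 0‖⁻¹ ^ lam ≤ sph lam g ∧ sph lam g ≤ Real.exp (|lam - 1| * cartanT g) := by
  obtain ⟨c, hc, h⟩ := exists_mul_norm_mat_inv_rpow_le_sph lam
  exact ⟨c, hc, fun g => ⟨h g, sph_le_exp_abs_sub_one_mul_cartanT lam g⟩⟩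

/-! ### Paley–Wiener-type growth of the transform -/

/-- **The one-dimensional form**: for `R ≥ 0` and `u` interval-integrable on `[0, R]`,
`|∫_0^R sinh 2t u(t) φ_λ(a_t) dt| ≤ e^{|λ − 1| R} ∫_0^R sinh 2t |u(t)| dt`. -/
theorem abs_integral_mul_sph_hyp_le (lam : ℝ) {R : ℝ} (hR : 0 ≤ R) {u : ℝ → ℝ}
    (hu : IntervalIntegrable u volume 0 R) :
    |∫ t in (0 : ℝ)..R, Real.sinh (2 * t) * u t * sph lam (hyp t)|
      ≤ Real.exp (|lam - 1| * R) * ∫ t in (0 : ℝ)..R, Real.sinh (2 * t) * |u t| := by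
  have hcs : Continuous fun t : ℝ => Real.sinh (2 * t) := by fun_prop
  have hint1 : IntervalIntegrable (fun t => Real.sinh (2 * t) * u t * sph lam (hyp t)) volume 0 R :=
    ((hu.continuousOn_mul hcs.continuousOn).mul_continuousOn (continuous_sph_hyp lam).continuousOn)
  have hint2 : IntervalIntegrable (fun t => Real.sinh (2 * t) * |u t|) volume 0 R :=
    hu.abs.continuousOn_mul hcs.continuousOn
  calc |∫ t in (0 : ℝ)..R, Real.sinh (2 * t) * u t * sph lam (hyp t)|
      ≤ ∫ t in (0 : ℝ)..R, |Real.sinh (2 * t) * u t * sph lam (hyp t)| :=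
        intervalIntegral.abs_integral_le_integral_abs hR
    _ ≤ ∫ t in (0 : ℝ)..R, Real.exp (|lam - 1| * R) * (Real.sinh (2 * t) * |u t|) := by
        refine integral_mono_on hR hint1.abs (hint2.const_mul _) fun t ht => ?_
        have hs : 0 ≤ Real.sinh (2 * t) := Real.sinh_nonneg_iff.mpr (by linarith [ht.1])
        have hφ := sph_hyp_pos lam t
        rw [abs_mul, abs_mul, abs_of_nonneg hs, abs_of_pos hφ]
        have hle : sph lam (hyp t) ≤ Real.exp (|lam - 1| * R) :=
          (sph_hyp_le_exp_abs_sub_one lam ht.1).trans (Real.exp_le_exp.mpr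
            (mul_le_mul_of_nonneg_left ht.2 (abs_nonneg _)))
        calc Real.sinh (2 * t) * |u t| * sph lam (hyp t)
            ≤ Real.sinh (2 * t) * |u t| * Real.exp (|lam - 1| * R) :=
              mul_le_mul_of_nonneg_left hle (by positivity)
          _ = Real.exp (|lam - 1| * R) * (Real.sinh (2 * t) * |u t|) := by ring
    _ = Real.exp (|lam - 1| * R) * ∫ t in (0 : ℝ)..R, Real.sinh (2 * t) * |u t| :=
        intervalIntegral.integral_const_mul _ _

/-- **THE PALEY–WIENER-TYPE GROWTH BOUND ON THE GROUP**: if `f ∈ L¹(ν)` vanishes outside the Cartan ball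
`{T(g) ≤ R}`, then `|∫_G f φ_λ dν| ≤ e^{|λ − 1| R} ∫_G |f| dν` for every `λ` (`R` arbitrary; for `R < 0` the
hypothesis forces `f = 0`). -/
theorem norm_integral_mul_sph_le_of_cartan_support {f : SU11 → ℝ} (hf : Integrable f (nu haarCircle))
    {R : ℝ} (hsupp : ∀ g, R < cartanT g → f g = 0) (lam : ℝ) :
    ‖∫ g, f g * sph lam g ∂(nu haarCircle)‖
      ≤ Real.exp (|lam - 1| * R) * ∫ g, ‖f g‖ ∂(nu haarCircle) := by
  have hbound : ∀ g, ‖f g * sph lam g‖ ≤ Real.exp (|lam - 1| * R) * ‖f g‖ := by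
    intro g
    rw [norm_mul, Real.norm_eq_abs (sph lam g), abs_of_pos (sph_pos lam g)]
    rcases le_or_gt (cartanT g) R with h | h
    · have hle : sph lam g ≤ Real.exp (|lam - 1| * R) :=
        (sph_le_exp_abs_sub_one_mul_cartanT lam g).trans (Real.exp_le_exp.mpr
          (mul_le_mul_of_nonneg_left h (abs_nonneg _)))
      calc ‖f g‖ * sph lam g ≤ ‖f g‖ * Real.exp (|lam - 1| * R) :=
            mul_le_mul_of_nonneg_left hle (norm_nonneg _)
        _ = Real.exp (|lam - 1| * R) * ‖f g‖ := by ring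
    · rw [hsupp g h, norm_zero, zero_mul, mul_zero]
  calc ‖∫ g, f g * sph lam g ∂(nu haarCircle)‖
      ≤ ∫ g, ‖f g * sph lam g‖ ∂(nu haarCircle) := norm_integral_le_integral_norm _
    _ ≤ ∫ g, Real.exp (|lam - 1| * R) * ‖f g‖ ∂(nu haarCircle) := by
        refine integral_mono_of_nonneg (Filter.Eventually.of_forall fun g => norm_nonneg _)
          (hf.norm.const_mul _) (Filter.Eventually.of_forall hbound)
    _ = Real.exp (|lam - 1| * R) * ∫ g, ‖f g‖ ∂(nu haarCircle) := integral_const_mul _ _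

end measure

end Summit.Ventures.HodgeRepro2.T5SU11SphericalGrowth
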